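import Mathlib
import HarnessLib
import Summits.Ventures.LatticeQCDFlow.Scaling.AutoregressiveGaugeHeatBathExact2D
import Summits.Ventures.LatticeQCDFlow.Exactness.FlowSamplerOperator

/-!
# LatticeQCDFlow / Scaling — SUFFICIENCY IN TWO DIMENSIONS, THE ORDER: an explicit bottom-up generation order
# of ALL links along which the one-plaquette heat-bath conditioners read only EARLIER links

HONEST FRAMING: exact (Metropolis-corrected) sampling algorithms for lattice gauge theory;
figures of merit are autocorrelation/cost numbers at stated couplings and volumes; no
continuum-physics claim.

Venture `LatticeQCDFlow` (cell pub-lqcd), topic `Scaling`, FANOUT row 30 (lean-1, GEN-22) — OUR WORK, the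
companion of `Scaling/AutoregressiveGaugeHeatBathExact2D`: there the hybrid built from the heat-bath family
`q_b = ∏_{p ∈ B, (p + e₁, 0) = b} w(U_p)/c` was shown to equal the free-boundary block target `F/Z` for every
duplicate-free list of all links, and each `q_b` to be normalised, squeezed and local.  For the hybrid to be an
AUTOREGRESSIVE model in the lineage's sense the list must also satisfy the pairwise condition «`q_a` does not
read any later link `b`» (`Scaling/AutoregressiveProposal*`: `l.Pairwise (fun a b => q a (U[b ↦ v]) = q a U)`).
Here such a list is CONSTRUCTED: all non-top links first (in any order), then the top links row by row from
the bottom (`b = 0, …, T₀ − 1`), left to right within a row.  A top link `(p + e₁, 0)` of the plaquette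
`p = ![i + a, j + b]` reads only `p`'s four links — its own link, the two vertical links (non-top, earlier)
and the bottom link `(p, 0)`, which is either a non-top link or the top link of the plaquette BELOW (row
`b − 1`, earlier); no later top link is among them (`T₀ + 1 ≤ L` rules out the wrap-around).

## What is proved (all [ours]; `0 < R`, `R + 1 ≤ L`, `T₀ + 1 ≤ L`; `c` any real)

* §1 `topLink_vec2`, `topLink_eq_iff` (injectivity of `(a, b) ↦ (![i + a, j + b] + e₁, 0)` on `a < R`, `b < T₀`),
  `eq_of_top_eq`,
  `heatBath_top_update_top` (for `(a₁, b₁) ≠ (a₂, b₂)` with `b₁ ≤ b₂`: `q_{top(a₁,b₁)}` ignores the link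
  `top(a₂, b₂)`), `heatBath_eq_one_of_not_top` (a link topping no block plaquette has `q_b ≡ 1`).
* §2 **`exists_bottomUp_order`** — there is a list `l` of links with `l.Nodup`, `∀ e, e ∈ l`, and
  `l.Pairwise (fun a b => ∀ U v, q_a(U[b ↦ v]) = q_a(U))`.
* §3 **`freeBlock_imhAcceptQ_eq_one`** — the exact independence sampler with target weight `F` and proposal
  density `H_l` ACCEPTS EVERY PROPOSAL: `α(U, V) = min(1, F(V)H_l(U)/(F(U)H_l(V))) = 1`;
  **`freeBlock_imhOp_eq_integral`** — its one-step operator is independent resampling,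
  `(P g)(U) = ∫ g·H_l dHaar^{⊗E}`.

Together with `freeBlock_arHybrid_eq_target` / `heatBath_integral_update_eq_one` / `heatBath_squeezed`: the
heat-bath family is an admissible autoregressive conditioner family along `l` and its exact independence
sampler has proposal = target.  No `def`, no `sorry`, nothing cited as a fact beyond the tree.
-/

noncomputable section

namespace Summit.Ventures.LatticeQCDFlow.Theory2.Autoregressive

open MeasureTheory Function Finset
open Literature.MathematicalPhysics.QuantumFieldTheory Literature.MathematicalPhysics.QuantumLattice
open Summit.Ventures.LatticeQCDFlow.Exactness Summit.Ventures.LatticeQCDFlow.Scoring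
open Summit.Ventures.LatticeQCDFlow.Theory2.Lattice Summit.Ventures.LatticeQCDFlow.Theory2.Lattice.TwoDim

variable {L : ℕ} [NeZero L] {G : Type*} [Group G]

/-! ## §1 Top links -/

omit [NeZero L] in
/-- The top link of `![x, y]` is `(![x, y + 1], 0)`. [ours] -/
theorem topLink_vec2 (x y : ZMod L) :
    ((Site.shift (![x, y] : Site 2 L) 1, (0 : Fin 2)) : Edge 2 L) = (![x, y + 1], 0) := by
  simp only [Site.shift, vec2_add_single_one]

omit [NeZero L] in
/-- Injectivity of the top-link map on the block indices. [ours] -/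
theorem topLink_eq_iff (i j : ZMod L) {R T₀ : ℕ} (hR : R ≤ L) (hT₀ : T₀ ≤ L) {a₁ b₁ a₂ b₂ : ℕ}
    (ha₁ : a₁ < R) (hb₁ : b₁ < T₀) (ha₂ : a₂ < R) (hb₂ : b₂ < T₀) :
    ((Site.shift (![i + a₁, j + b₁] : Site 2 L) 1, (0 : Fin 2)) : Edge 2 L) =
        (Site.shift (![i + a₂, j + b₂] : Site 2 L) 1, 0) ↔ a₁ = a₂ ∧ b₁ = b₂ := by
  rw [topLink_vec2, topLink_vec2]
  constructor
  · intro h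
    have h' := vec2_eq_iff.mp (congrArg Prod.fst h)
    have h1 : ((a₁ : ℕ) : ZMod L) = a₂ := add_left_cancel h'.1
    have h2 : ((b₁ : ℕ) : ZMod L) = b₂ := by
      have := h'.2; rw [add_assoc, add_assoc, add_comm (b₁ : ZMod L), add_comm (b₂ : ZMod L)] at this
      exact add_left_cancel (add_left_cancel this)
    refine ⟨?_, ?_⟩
    · by_contra hne; exact natCast_zmod_ne_of_lt (L := L) (by omega) (by omega) hne h1
    · by_contra hne; exact natCast_zmod_ne_of_lt (L := L) (by omega) (by omega) hne h2
  · rintro ⟨rfl, rfl⟩; rfl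

omit [NeZero L] in
/-- A plaquette whose top link is `top(a₁, b₁)` IS `![i + a₁, j + b₁]`. [ours] -/
theorem eq_of_top_eq (i j : ZMod L) {a₁ b₁ : ℕ} {p : Site 2 L}
    (ht : ((Site.shift p 1, (0 : Fin 2)) : Edge 2 L) = (Site.shift (![i + a₁, j + b₁] : Site 2 L) 1, 0)) :
    p = ![i + a₁, j + b₁] := by
  have h1 : p + Pi.single (1 : Fin 2) (1 : ZMod L) = (![i + a₁, j + b₁] : Site 2 L) + Pi.single (1 : Fin 2) 1 :=
    congrArg Prod.fst ht
  exact add_right_cancel h1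

omit [NeZero L] in
/-- **Bottom-up locality**: for block indices `(a₁, b₁) ≠ (a₂, b₂)` with `b₁ ≤ b₂`, the conditioner of the top
link `top(a₁, b₁)` ignores the link `top(a₂, b₂)` (`T₀ + 1 ≤ L`: no wrap-around). [ours] -/
theorem heatBath_top_update_top {w : G → ℝ} (c : ℝ) (i j : ZMod L) {R T₀ : ℕ} (hR : R + 1 ≤ L)
    (hT₀ : T₀ + 1 ≤ L) {a₁ b₁ a₂ b₂ : ℕ} (ha₁ : a₁ < R) (hb₁ : b₁ < T₀) (ha₂ : a₂ < R) (hb₂ : b₂ < T₀)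
    (hne : (a₁, b₁) ≠ (a₂, b₂)) (hle : b₁ ≤ b₂) (U : GaugeConfig 2 L G) (v : G) :
    ∏ p ∈ ((range R ×ˢ range T₀).image (fun q : ℕ × ℕ => (![i + q.1, j + q.2] : Site 2 L))).filter
        (fun p' : Site 2 L => ((Site.shift p' 1, (0 : Fin 2)) : Edge 2 L) =
          (Site.shift (![i + a₁, j + b₁] : Site 2 L) 1, 0)),
        w (plaquetteHolonomy (update U ((Site.shift (![i + a₂, j + b₂] : Site 2 L) 1, (0 : Fin 2))) v) p 0 1) / c =
      ∏ p ∈ ((range R ×ˢ range T₀).image (fun q : ℕ × ℕ => (![i + q.1, j + q.2] : Site 2 L))).filter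
        (fun p' : Site 2 L => ((Site.shift p' 1, (0 : Fin 2)) : Edge 2 L) =
          (Site.shift (![i + a₁, j + b₁] : Site 2 L) 1, 0)),
        w (plaquetteHolonomy U p 0 1) / c := by
  refine heatBath_update_of_forall_ne c _ _ _ (fun p _ hpt => ?_) U v
  have hpeq := eq_of_top_eq i j hpt
  subst hpeq
  have h01 : ((0 : Fin 2)) ≠ 1 := by decide
  refine ⟨?_, ?_, ?_, ?_⟩
  · -- bottom link `(p, 0)` vs `top(a₂, b₂) = (![i + a₂, j + b₂ + 1], 0)`: `b₁ = b₂ + 1` is impossible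
    intro h
    rw [topLink_vec2] at h
    have h' := vec2_eq_iff.mp (congrArg Prod.fst h)
    have h2 : ((b₁ : ℕ) : ZMod L) = ((b₂ + 1 : ℕ) : ZMod L) := by
      have := h'.2; push_cast at this ⊢
      rw [add_assoc] at this
      exact add_left_cancel this
    exact natCast_zmod_ne_of_lt (L := L) (by omega) (by omega) (by omega) h2
  · intro h; exact h01.symm (congrArg Prod.snd h)
  · intro h
    have := (topLink_eq_iff i j (by omega : R ≤ L) (by omega : T₀ ≤ L) ha₁ hb₁ ha₂ hb₂).mp h
    exact hne (by rw [this.1, this.2])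
  · intro h; exact h01.symm (congrArg Prod.snd h)

omit [NeZero L] in
/-- A link that tops no block plaquette has the trivial conditioner `q_b ≡ 1`. [ours] -/
theorem heatBath_eq_one_of_not_top {w : G → ℝ} (c : ℝ) (B : Finset (Site 2 L)) {b : Edge 2 L}
    (hb : ∀ p ∈ B, ((Site.shift p 1, (0 : Fin 2)) : Edge 2 L) ≠ b) (U : GaugeConfig 2 L G) :
    ∏ p ∈ B.filter (fun p' : Site 2 L => ((Site.shift p' 1, (0 : Fin 2)) : Edge 2 L) = b),
        w (plaquetteHolonomy U p 0 1) / c = 1 := by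
  rw [filter_topLink_eq_empty B hb, prod_empty]

/-! ## §2 The bottom-up order -/

/-- **A BOTTOM-UP GENERATION ORDER EXISTS.**  `0 < R`, `R + 1 ≤ L`, `T₀ + 1 ≤ L`: there is a duplicate-free
list of ALL links of `(ℤ/L)²` along which every heat-bath conditioner `q_a` ignores every later link `b` —
all non-top links first, then the top links of the block row by row from the bottom. [ours] -/
theorem exists_bottomUp_order {w : G → ℝ} (c : ℝ) (i j : ZMod L) {R T₀ : ℕ} (hR : R + 1 ≤ L)
    (hT₀ : T₀ + 1 ≤ L) :
    ∃ l : List (Edge 2 L), l.Nodup ∧ (∀ e : Edge 2 L, e ∈ l) ∧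
      l.Pairwise (fun a b => ∀ (U : GaugeConfig 2 L G) (v : G),
        ∏ p ∈ ((range R ×ˢ range T₀).image (fun q : ℕ × ℕ => (![i + q.1, j + q.2] : Site 2 L))).filter
            (fun p' : Site 2 L => ((Site.shift p' 1, (0 : Fin 2)) : Edge 2 L) = a),
            w (plaquetteHolonomy (update U b v) p 0 1) / c =
          ∏ p ∈ ((range R ×ˢ range T₀).image (fun q : ℕ × ℕ => (![i + q.1, j + q.2] : Site 2 L))).filter
            (fun p' : Site 2 L => ((Site.shift p' 1, (0 : Fin 2)) : Edge 2 L) = a),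
            w (plaquetteHolonomy U p 0 1) / c) := by
  classical
  set B : Finset (Site 2 L) := (range R ×ˢ range T₀).image (fun q : ℕ × ℕ => (![i + q.1, j + q.2] : Site 2 L))
    with hB
  -- the top links, row by row from the bottom
  let top : ℕ → ℕ → Edge 2 L := fun a b => ((Site.shift (![i + a, j + b] : Site 2 L) 1, (0 : Fin 2)) : Edge 2 L)
  let row : ℕ → List (Edge 2 L) := fun b => (List.range R).map (fun a => top a b)
  let tops : List (Edge 2 L) := (List.range T₀).flatMap row
  let rest : List (Edge 2 L) := (Finset.univ.filter (fun e : Edge 2 L => e ∉ tops)).toList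
  -- the relation
  set P : Edge 2 L → Edge 2 L → Prop := fun a b => ∀ (U : GaugeConfig 2 L G) (v : G),
      ∏ p ∈ B.filter (fun p' : Site 2 L => ((Site.shift p' 1, (0 : Fin 2)) : Edge 2 L) = a),
          w (plaquetteHolonomy (update U b v) p 0 1) / c =
        ∏ p ∈ B.filter (fun p' : Site 2 L => ((Site.shift p' 1, (0 : Fin 2)) : Edge 2 L) = a),
          w (plaquetteHolonomy U p 0 1) / c with hP
  have hmem_tops : ∀ {e : Edge 2 L}, e ∈ tops ↔ ∃ a b, a < R ∧ b < T₀ ∧ top a b = e := by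
    intro e
    simp only [tops, row, List.mem_flatMap, List.mem_range, List.mem_map]
    constructor
    · rintro ⟨b, hb, a, ha, h⟩; exact ⟨a, b, ha, hb, h⟩
    · rintro ⟨a, b, ha, hb, h⟩; exact ⟨b, hb, a, ha, h⟩
  -- every block plaquette's top link is in `tops`
  have htop_mem : ∀ p ∈ B, ((Site.shift p 1, (0 : Fin 2)) : Edge 2 L) ∈ tops := by
    intro p hp
    rw [hB, mem_image] at hp
    obtain ⟨q, hq, rfl⟩ := hp
    rw [mem_product, mem_range, mem_range] at hq
    exact hmem_tops.mpr ⟨q.1, q.2, hq.1, hq.2, rfl⟩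
  -- a non-top link has the trivial conditioner, hence `P a b` for every `b`
  have hP_rest : ∀ a, a ∉ tops → ∀ b, P a b := by
    intro a ha b U v
    have hb : ∀ p ∈ B, ((Site.shift p 1, (0 : Fin 2)) : Edge 2 L) ≠ a := fun p hp h => ha (h ▸ htop_mem p hp)
    rw [heatBath_eq_one_of_not_top c B hb, heatBath_eq_one_of_not_top c B hb]
  -- `P` between top links in bottom-up position
  have hP_top : ∀ {a₁ b₁ a₂ b₂ : ℕ}, a₁ < R → b₁ < T₀ → a₂ < R → b₂ < T₀ → (a₁, b₁) ≠ (a₂, b₂) → b₁ ≤ b₂ →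
      P (top a₁ b₁) (top a₂ b₂) := by
    intro a₁ b₁ a₂ b₂ ha₁ hb₁ ha₂ hb₂ hne hle U v
    exact heatBath_top_update_top c i j hR hT₀ ha₁ hb₁ ha₂ hb₂ hne hle U v
  refine ⟨rest ++ tops, ?_, ?_, ?_⟩
  · -- Nodup
    rw [List.nodup_append]
    refine ⟨Finset.nodup_toList _, ?_, ?_⟩
    · -- tops.Nodup
      simp only [tops]
      rw [List.nodup_flatMap]
      constructor
      · intro b hb
        rw [List.mem_range] at hb
        simp only [row]
        refine (List.nodup_range.map_on ?_)
        intro a₁ ha₁ a₂ ha₂ h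
        rw [List.mem_range] at ha₁ ha₂
        exact ((topLink_eq_iff i j (by omega : R ≤ L) (by omega : T₀ ≤ L) ha₁ hb ha₂ hb).mp h).1
      · refine List.Pairwise.imp_of_mem ?_ (List.pairwise_lt_range)
        intro b₁ b₂ hb₁ hb₂ hlt
        rw [List.mem_range] at hb₁ hb₂
        simp only [row, Function.onFun, List.disjoint_left, List.mem_map, List.mem_range]
        rintro e ⟨a₁, ha₁, rfl⟩ ⟨a₂, ha₂, h⟩
        have := ((topLink_eq_iff i j (by omega : R ≤ L) (by omega : T₀ ≤ L) ha₂ hb₂ ha₁ hb₁).mp h).2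
        omega
    · -- disjoint
      intro e he e' he' hee'
      rw [Finset.mem_toList, mem_filter] at he
      exact he.2 (hee' ▸ he')
  · -- all links
    intro e
    by_cases he : e ∈ tops
    · exact List.mem_append_right _ he
    · exact List.mem_append_left _ (Finset.mem_toList.mpr (mem_filter.mpr ⟨mem_univ _, he⟩))
  · -- Pairwise
    rw [List.pairwise_append]
    refine ⟨?_, ?_, ?_⟩
    · refine List.Pairwise.imp_of_mem ?_ (Finset.nodup_toList _)
      intro a b ha _ _
      rw [Finset.mem_toList, mem_filter] at ha
      exact hP_rest a ha.2 b
    · -- tops pairwise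
      simp only [tops]
      rw [List.pairwise_flatMap]
      constructor
      · intro b hb
        rw [List.mem_range] at hb
        simp only [row]
        rw [List.pairwise_map]
        refine List.Pairwise.imp_of_mem ?_ (List.pairwise_lt_range)
        intro a₁ a₂ ha₁ ha₂ hlt
        rw [List.mem_range] at ha₁ ha₂
        exact hP_top ha₁ hb ha₂ hb (fun h => by simp only [Prod.mk.injEq] at h; omega) le_rfl
      · refine List.Pairwise.imp_of_mem ?_ (List.pairwise_lt_range)
        intro b₁ b₂ hb₁ hb₂ hlt
        rw [List.mem_range] at hb₁ hb₂
        simp only [row, List.mem_map, List.mem_range]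
        rintro x ⟨a₁, ha₁, rfl⟩ y ⟨a₂, ha₂, rfl⟩
        exact hP_top ha₁ hb₁ ha₂ hb₂ (fun h => by simp only [Prod.mk.injEq] at h; omega) hlt.le
    · intro a ha b _
      rw [Finset.mem_toList, mem_filter] at ha
      exact hP_rest a ha.2 b


/-! ## §3 The exact sampler accepts every proposal -/

/-- **Acceptance one.**  `w` continuous and positive, `0 < R`, `R + 1 ≤ L`, `T₀ + 1 ≤ L`, `l` a duplicate-free
list of ALL links: the independence-sampler acceptance with target weight `F = ∏_{p∈B} w(U_p)` and proposal
density `H_l` is identically `1`. [ours] -/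
theorem freeBlock_imhAcceptQ_eq_one [TopologicalSpace G] [IsTopologicalGroup G] [CompactSpace G]
    [SecondCountableTopology G] [MeasurableSpace G] [BorelSpace G]
    {w : G → ℝ} (hw : Continuous w) (hw0 : ∀ g, 0 < w g) (i j : ZMod L)
    {R T₀ : ℕ} (hR0 : 0 < R) (hR : R + 1 ≤ L) (hT₀ : T₀ + 1 ≤ L)
    (l : List (Edge 2 L)) (hl : l.Nodup) (hall : ∀ e : Edge 2 L, e ∈ l) (U V : GaugeConfig 2 L G) :
    imhAcceptQ
        (fun U : GaugeConfig 2 L G => ∏ p ∈ (range R ×ˢ range T₀).image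
          (fun q : ℕ × ℕ => (![i + q.1, j + q.2] : Site 2 L)), w (plaquetteHolonomy U p 0 1))
        (fun U : GaugeConfig 2 L G => (l.map fun b => ∏ p ∈ ((range R ×ˢ range T₀).image
            (fun q : ℕ × ℕ => (![i + q.1, j + q.2] : Site 2 L))).filter
              (fun p' : Site 2 L => ((Site.shift p' 1, (0 : Fin 2)) : Edge 2 L) = b),
            w (plaquetteHolonomy U p 0 1) / (∫ g, w g ∂(haarProbability G))).prod *
          coordAvg (haarProbability G) l.toFinset
            (fun V : GaugeConfig 2 L G => ∏ p ∈ (range R ×ˢ range T₀).image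
              (fun q : ℕ × ℕ => (![i + q.1, j + q.2] : Site 2 L)), w (plaquetteHolonomy V p 0 1)) U /
          (∫ V, ∏ p ∈ (range R ×ˢ range T₀).image (fun q : ℕ × ℕ => (![i + q.1, j + q.2] : Site 2 L)),
            w (plaquetteHolonomy V p 0 1) ∂(Measure.pi fun _ : Edge 2 L => haarProbability G)))
        U V = 1 := by
  unfold imhAcceptQ
  beta_reduce
  rw [freeBlock_arHybrid_eq_target (G := G) hw hw0 i j hR0 hR hT₀ l hl hall U,
    freeBlock_arHybrid_eq_target (G := G) hw hw0 i j hR0 hR hT₀ l hl hall V]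
  have hc : 0 < ∫ g, w g ∂(haarProbability G) := haarProbability_integral_pos_of_continuous_pos hw hw0
  have hZ := freeBlock_integral_prod_eq_pow (G := G) hw i j hR0 hR hT₀
  have hZpos : 0 < ∫ V, ∏ p ∈ (range R ×ˢ range T₀).image (fun q : ℕ × ℕ => (![i + q.1, j + q.2] : Site 2 L)),
      w (plaquetteHolonomy V p 0 1) ∂(Measure.pi fun _ : Edge 2 L => haarProbability G) := by
    rw [hZ]; exact pow_pos hc _
  have hFU : 0 < ∏ p ∈ (range R ×ˢ range T₀).image (fun q : ℕ × ℕ => (![i + q.1, j + q.2] : Site 2 L)),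
      w (plaquetteHolonomy U p 0 1) := prod_pos fun p _ => hw0 _
  have hFV : 0 < ∏ p ∈ (range R ×ˢ range T₀).image (fun q : ℕ × ℕ => (![i + q.1, j + q.2] : Site 2 L)),
      w (plaquetteHolonomy V p 0 1) := prod_pos fun p _ => hw0 _
  rw [show (∏ p ∈ (range R ×ˢ range T₀).image (fun q : ℕ × ℕ => (![i + q.1, j + q.2] : Site 2 L)),
        w (plaquetteHolonomy V p 0 1)) *
      ((∏ p ∈ (range R ×ˢ range T₀).image (fun q : ℕ × ℕ => (![i + q.1, j + q.2] : Site 2 L)),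
        w (plaquetteHolonomy U p 0 1)) /
      (∫ V, ∏ p ∈ (range R ×ˢ range T₀).image (fun q : ℕ × ℕ => (![i + q.1, j + q.2] : Site 2 L)),
            w (plaquetteHolonomy V p 0 1) ∂(Measure.pi fun _ : Edge 2 L => haarProbability G))) /
      ((∏ p ∈ (range R ×ˢ range T₀).image (fun q : ℕ × ℕ => (![i + q.1, j + q.2] : Site 2 L)),
        w (plaquetteHolonomy U p 0 1)) *
      ((∏ p ∈ (range R ×ˢ range T₀).image (fun q : ℕ × ℕ => (![i + q.1, j + q.2] : Site 2 L)),
        w (plaquetteHolonomy V p 0 1)) /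
      (∫ V, ∏ p ∈ (range R ×ˢ range T₀).image (fun q : ℕ × ℕ => (![i + q.1, j + q.2] : Site 2 L)),
            w (plaquetteHolonomy V p 0 1) ∂(Measure.pi fun _ : Edge 2 L => haarProbability G)))) = 1 by
    field_simp]
  exact min_self 1

/-- **Independent resampling.**  Under the same hypotheses the sampler's one-step operator is
`(P g)(U) = ∫ g(V)·H_l(V) dHaar^{⊗E}(V)` for every observable `g` and every state `U`. [ours] -/
theorem freeBlock_imhOp_eq_integral [TopologicalSpace G] [IsTopologicalGroup G] [CompactSpace G]
    [SecondCountableTopology G] [MeasurableSpace G] [BorelSpace G]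
    {w : G → ℝ} (hw : Continuous w) (hw0 : ∀ g, 0 < w g) (i j : ZMod L)
    {R T₀ : ℕ} (hR0 : 0 < R) (hR : R + 1 ≤ L) (hT₀ : T₀ + 1 ≤ L)
    (l : List (Edge 2 L)) (hl : l.Nodup) (hall : ∀ e : Edge 2 L, e ∈ l) (g : GaugeConfig 2 L G → ℝ)
    (U : GaugeConfig 2 L G) :
    imhOp (Measure.pi fun _ : Edge 2 L => haarProbability G)
        (fun U : GaugeConfig 2 L G => ∏ p ∈ (range R ×ˢ range T₀).image
          (fun q : ℕ × ℕ => (![i + q.1, j + q.2] : Site 2 L)), w (plaquetteHolonomy U p 0 1))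
        (fun U : GaugeConfig 2 L G => (l.map fun b => ∏ p ∈ ((range R ×ˢ range T₀).image
            (fun q : ℕ × ℕ => (![i + q.1, j + q.2] : Site 2 L))).filter
              (fun p' : Site 2 L => ((Site.shift p' 1, (0 : Fin 2)) : Edge 2 L) = b),
            w (plaquetteHolonomy U p 0 1) / (∫ g, w g ∂(haarProbability G))).prod *
          coordAvg (haarProbability G) l.toFinset
            (fun V : GaugeConfig 2 L G => ∏ p ∈ (range R ×ˢ range T₀).image
              (fun q : ℕ × ℕ => (![i + q.1, j + q.2] : Site 2 L)), w (plaquetteHolonomy V p 0 1)) U /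
          (∫ V, ∏ p ∈ (range R ×ˢ range T₀).image (fun q : ℕ × ℕ => (![i + q.1, j + q.2] : Site 2 L)),
            w (plaquetteHolonomy V p 0 1) ∂(Measure.pi fun _ : Edge 2 L => haarProbability G)))
        g U =
      ∫ V, g V * ((l.map fun b => ∏ p ∈ ((range R ×ˢ range T₀).image
            (fun q : ℕ × ℕ => (![i + q.1, j + q.2] : Site 2 L))).filter
              (fun p' : Site 2 L => ((Site.shift p' 1, (0 : Fin 2)) : Edge 2 L) = b),
            w (plaquetteHolonomy V p 0 1) / (∫ g, w g ∂(haarProbability G))).prod *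
          coordAvg (haarProbability G) l.toFinset
            (fun V' : GaugeConfig 2 L G => ∏ p ∈ (range R ×ˢ range T₀).image
              (fun q : ℕ × ℕ => (![i + q.1, j + q.2] : Site 2 L)), w (plaquetteHolonomy V' p 0 1)) V /
          (∫ V', ∏ p ∈ (range R ×ˢ range T₀).image (fun q : ℕ × ℕ => (![i + q.1, j + q.2] : Site 2 L)),
            w (plaquetteHolonomy V' p 0 1) ∂(Measure.pi fun _ : Edge 2 L => haarProbability G)))
        ∂(Measure.pi fun _ : Edge 2 L => haarProbability G) := by
  unfold imhOp
  refine integral_congr_ae (ae_of_all _ fun V => ?_)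
  beta_reduce
  rw [freeBlock_imhAcceptQ_eq_one (G := G) hw hw0 i j hR0 hR hT₀ l hl hall U V]
  ring

end Summit.Ventures.LatticeQCDFlow.Theory2.Autoregressive

end
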